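import Mathlib
import Literature.Analysis.FunctionSpaces.TorusLinearisedNSEnergy
import Literature.Analysis.FunctionSpaces.TorusLinearisedFormTruncation
import Literature.Analysis.FunctionSpaces.TorusConvectionLaplacianNormSq
import Literature.Analysis.FunctionSpaces.TorusTestFunction
import Summits.NavierStokesRegularity.FluidComputer.HighModePoincare
import HarnessLib

/-!
# The `H¹` and `L²` tails of the linearised Navier–Stokes operator are dissipative beyond an explicit mode number (cap g4, cell `ns-blowup`, 2026-08-26)

HONEST FRAMING (human ruling D-0035): nothing here is a claim about Navier–Stokes blow-up.
WHAT THIS IS NOT: not NS evidence. Kernel form (ball-truncation geometry, generic constants) of the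
two LOWER tail levels (T1)/(T0) of `cap/D2-TAIL-KAPPA0.md` — the `κ₀ > 0` companions of the `H²`
level `H2TailDissipativity.tail_form_le` (THEOREM 3-L, `instab/INSTAB-BRIDGE.md` §11 l.109, §12 (L5),
in the booking norm `g_κ₀`; combination of the three levels: `AbcKappa0TailLevels.weighted_levels_le`).
For a smooth divergence-free host `v` with the STRAIN bound `|⟪a, Dv(x)a⟫| ≤ s‖a‖²`, the gradient
bound `‖∂ₖv(x)‖ ≤ L` and the Hessian-row bound `(∑ⱼ‖∂ⱼ∂ₖv(x)‖²)^{1/2} ≤ L'`, and a smooth TAIL field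
`w` (no Fourier modes in the ball `|k|² ≤ N²`, `Λ_N = 4π²(N² + 1)`):

* `l2_tail_form_le` — (T0) `ν∫⟪Δw, w⟫ − ∫⟪(v·∇)w + (w·∇)v, w⟫ − ω‖w‖₂² ≤ (−νΛ_N − ω + s)·‖w‖₂²`
  (transport is skew, the stretching form is the strain form, Poincaré once).
* `h1_tail_form_le` — (T1) `−ν‖Δw‖₂² + ∫⟪(v·∇)w + (w·∇)v, Δw⟫ − ω‖∇w‖₂²
  ≤ (−νΛ_N − ω + √d·L + s + √d·L'/√Λ_N)·‖∇w‖₂²` (one integration by parts; the top-order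
  transport term `∫⟪∂ₘw, (v·∇)∂ₘw⟫` vanishes, the rest is first order in `v`'s derivatives:
  `√d·L` from `∑ₘ⟪∂ₘw, (∂ₘv·∇)w⟫` via the Frobenius bound `‖(a·∇)b‖ ≤ ‖a‖·|∇b|_F`, `s` from
  `∑ₘ⟪∂ₘw, (∂ₘw·∇)v⟫`, `√d·L'/√Λ_N` from `∑ₘ⟪∂ₘw, (w·∇)∂ₘv⟫` and Poincaré).
* tools: `integral_inner_convect_self_eq_zero'` (skewness), `abs_integral_inner_convect_le_of_strain`,
  `integral_inner_laplacian_eq_neg_sum` (`∫⟪F, Δw⟫ = −∑ₘ∫⟪∂ₘF, ∂ₘw⟫`),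
  `sum_sqrt_le_sqrt_card_mul_sqrt_sum` (Cauchy–Schwarz in the direction index).

For `U = abc(1,1,1)` on `(ℝ/2πℤ)³` (cube-shell tail `|k|_∞ ≥ K + 1`, so `|k| ≥ K + 1` plays the
role of `Λ_N^{1/2}`) the host constants are `s = √2` (`ABCHostStrainEnvelope`: `‖sym ∇U‖ ≤ √2`),
`L = 1`, `L' = 1` (`AbcH2TailConstants`: `|∂ᵢU| = |∂ᵢ²U| = 1`, `∂ⱼ∂ᵢU = 0` for `j ≠ i`), `d = 3`,
so the generic constants read `η₀ = ν(K+1)² + ω − √2` (= the memo's (T0)) and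
`η₁' = ν(K+1)² + ω − (√3 + √2) − √3/(K+1)` (the memo's (T1) has the sharper `1/(K+1)` in the last
term, using the diagonal Hessian componentwise; at `R = 100`, `ω = 11/50`, `K + 1 = 25`:
`η₁' = 3.254…`, `η₁ = 3.283…`, both far above the binding `H²` level `η₂ = 1.352…` — threshold
arithmetic in `AbcKappa0TailLevels`). The Leray projector is absent because the test fields `w`,
`−Δw` are divergence-free whenever `w` is (as in `H2TailDissipativity`).

Mathlib + the tree's torus calculus + the landed `HighModePoincare`; no new definitions.
-/

noncomputable section

namespace Summit.NavierStokesRegularity.FluidComputer.LinearisedLowerTailForms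

open Literature.Analysis.FunctionSpaces Literature.Analysis.FunctionSpaces.Torus MeasureTheory
open Summit.NavierStokesRegularity.FluidComputer.HighModePoincare
open scoped RealInnerProductSpace

variable {d : Type*} [Fintype d] [DecidableEq d]

/-! ## Tools -/

/-- **Transport by a divergence-free field is skew on a single field:** `∫⟪(v·∇)w, w⟫ = 0`
(antisymmetry of the trilinear form, `Torus.integral_inner_convect_eq_neg`, with both slots `w`). -/
theorem integral_inner_convect_self_eq_zero' {G : Type*} [NormedAddCommGroup G]
    [InnerProductSpace ℝ G] {v : UnitAddTorus d → EuclideanSpace ℝ d} {w : UnitAddTorus d → G}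
    (hv : IsSmooth v) (hdiv : IsDivFree v) (hw : IsSmooth w) :
    ∫ x, ⟪convect v w x, w x⟫ = 0 := by
  have h := integral_inner_convect_eq_neg hv hdiv hw hw
  have hsym : ∫ x, ⟪w x, convect v w x⟫ = ∫ x, ⟪convect v w x, w x⟫ :=
    integral_congr_ae (ae_of_all _ fun x => real_inner_comm _ _)
  rw [hsym] at h
  linarith

omit [DecidableEq d] in
/-- **The stretching form is controlled by the strain:** if `|⟪a, Dv(x)a⟫| ≤ s‖a‖²` for all `x, a`
(largest singular value of the symmetric part of `∇v`), then `|∫⟪(w·∇)v, w⟫| ≤ s ∫‖w‖²` for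
smooth `v, w` (pointwise, since `((w·∇)v)(x) = Dv(x)[w(x)]`). -/
theorem abs_integral_inner_convect_le_of_strain {v w : UnitAddTorus d → EuclideanSpace ℝ d}
    (hw : IsSmooth w) {s : ℝ}
    (hS : ∀ (x : UnitAddTorus d) (a : EuclideanSpace ℝ d), |⟪a, Torus.fderiv v x a⟫| ≤ s * ‖a‖ ^ 2) :
    |∫ x, ⟪convect w v x, w x⟫| ≤ s * ∫ x, ‖w x‖ ^ 2 := by
  have hpt : ∀ x, |⟪convect w v x, w x⟫| ≤ s * ‖w x‖ ^ 2 := by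
    intro x
    rw [real_inner_comm]
    exact hS x (w x)
  rw [← integral_const_mul]
  refine abs_integral_le_integral_abs.trans (integral_mono_of_nonneg ?_ ?_ ?_)
  · exact Filter.Eventually.of_forall fun x => abs_nonneg _
  · exact (hw.norm_sq.integrable).const_mul s
  · exact Filter.Eventually.of_forall hpt

/-- **Green's first identity against a general field:** `∫⟪F, Δw⟫ = −∑ₘ ∫⟪∂ₘF, ∂ₘw⟫` for smooth
`F, w` (`Δw = ∑ₘ∂ₘ∂ₘw` and `∫⟪∂ₘu, g⟫ = −∫⟪u, ∂ₘg⟫`). -/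
theorem integral_inner_laplacian_eq_neg_sum {G : Type*} [NormedAddCommGroup G]
    [InnerProductSpace ℝ G] {F w : UnitAddTorus d → G} (hF : IsSmooth F) (hw : IsSmooth w) :
    ∫ x, ⟪F x, laplacian w x⟫ = -∑ m, ∫ x, ⟪partialDeriv m F x, partialDeriv m w x⟫ := by
  have e : ∀ x, ⟪F x, laplacian w x⟫ = ∑ m, ⟪F x, partialDeriv m (partialDeriv m w) x⟫ := by
    intro x
    rw [laplacian_eq_sum_partialDeriv_partialDeriv hw, inner_sum]
  simp_rw [e]
  rw [integral_finsetSum _ fun m _ => (hF.inner ((hw.partialDeriv m).partialDeriv m)).integrable,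
    ← Finset.sum_neg_distrib]
  refine Finset.sum_congr rfl fun m _ => ?_
  have h1 : ∫ x, ⟪F x, partialDeriv m (partialDeriv m w) x⟫
      = ∫ x, ⟪partialDeriv m (partialDeriv m w) x, F x⟫ :=
    integral_congr_ae (ae_of_all _ fun x => real_inner_comm _ _)
  have h2 := integral_inner_partialDeriv_eq_neg (hw.partialDeriv m) hF m
  have h3 : ∫ x, ⟪partialDeriv m w x, partialDeriv m F x⟫
      = ∫ x, ⟪partialDeriv m F x, partialDeriv m w x⟫ :=
    integral_congr_ae (ae_of_all _ fun x => real_inner_comm _ _)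
  rw [h1, h2, h3]

omit [DecidableEq d] in
/-- **Cauchy–Schwarz in the direction index:** `∑ₘ √(fₘ) ≤ √(card d) · √(∑ₘ fₘ)` for `fₘ ≥ 0`. -/
theorem sum_sqrt_le_sqrt_card_mul_sqrt_sum (f : d → ℝ) (hf : ∀ m, 0 ≤ f m) :
    ∑ m, Real.sqrt (f m) ≤ Real.sqrt (Fintype.card d) * Real.sqrt (∑ m, f m) := by
  have hcs := Finset.sum_mul_sq_le_sq_mul_sq (Finset.univ : Finset d) (fun _ => (1:ℝ))
    (fun m => Real.sqrt (f m))
  have e1 : (∑ m : d, (fun _ => (1:ℝ)) m * Real.sqrt (f m)) = ∑ m, Real.sqrt (f m) := by simp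
  have e2 : (∑ m : d, ((fun _ => (1:ℝ)) m) ^ 2) = (Fintype.card d : ℝ) := by simp
  have e3 : (∑ m : d, Real.sqrt (f m) ^ 2) = ∑ m, f m :=
    Finset.sum_congr rfl fun m _ => Real.sq_sqrt (hf m)
  rw [e1, e2, e3] at hcs
  rw [← Real.sqrt_mul (Nat.cast_nonneg _)]
  exact Real.le_sqrt_of_sq_le hcs

/-- Pointwise: `∑ₘ ‖∂ₘw(x)‖ ≤ √(card d) · (∑ₘ ‖∂ₘw(x)‖²)^{1/2}`. -/
theorem sum_norm_partialDeriv_le_sqrt_card_mul {G : Type*} [NormedAddCommGroup G]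
    [NormedSpace ℝ G] (w : UnitAddTorus d → G) (x : UnitAddTorus d) :
    ∑ m, ‖partialDeriv m w x‖
      ≤ Real.sqrt (Fintype.card d) * Real.sqrt (∑ m, ‖partialDeriv m w x‖ ^ 2) := by
  have h := sum_sqrt_le_sqrt_card_mul_sqrt_sum (fun m => ‖partialDeriv m w x‖ ^ 2)
    (fun m => sq_nonneg _)
  have e : (∑ m, Real.sqrt (‖partialDeriv m w x‖ ^ 2)) = ∑ m, ‖partialDeriv m w x‖ :=
    Finset.sum_congr rfl fun m _ => Real.sqrt_sq (norm_nonneg _)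
  rwa [e] at h

/-! ## (T0) The `L²` level -/

/-- **(T0) `L²` tail dissipativity of the linearised operator.** For smooth divergence-free `v`
with strain bound `|⟪a, Dv(x)a⟫| ≤ s‖a‖²` and a smooth tail field `w` (`P_N w = 0`):
`ν∫⟪Δw, w⟫ − ∫⟪(v·∇)w + (w·∇)v, w⟫ − ω∫‖w‖² ≤ (−ν·4π²(N²+1) − ω + s)·∫‖w‖²`. -/
theorem l2_tail_form_le {v w : UnitAddTorus d → EuclideanSpace ℝ d}
    (hv : IsSmooth v) (hdiv : IsDivFree v) (hw : IsSmooth w) {N : ℕ}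
    (h0 : fourierTruncate N w = fun _ => 0) {ν ω s : ℝ} (hν : 0 ≤ ν)
    (hS : ∀ (x : UnitAddTorus d) (a : EuclideanSpace ℝ d), |⟪a, Torus.fderiv v x a⟫| ≤ s * ‖a‖ ^ 2) :
    ν * (∫ x, ⟪laplacian w x, w x⟫)
      - (∫ x, ⟪convect v w x + convect w v x, w x⟫)
      - ω * (∫ x, ‖w x‖ ^ 2)
      ≤ (-(ν * (4 * Real.pi ^ 2 * ((N : ℝ) ^ 2 + 1))) - ω + s) * (∫ x, ‖w x‖ ^ 2) := by
  set Λ : ℝ := 4 * Real.pi ^ 2 * ((N : ℝ) ^ 2 + 1) with hΛ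
  set Y : ℝ := ∫ x, ‖w x‖ ^ 2 with hY
  have hvisc : ∫ x, ⟪laplacian w x, w x⟫ = -gradNormSq w :=
    integral_inner_laplacian_self_eq_neg_gradNormSq_of_isSmooth hw
  have hP : Λ * Y ≤ gradNormSq w := integral_norm_sq_le_of_truncate_eq_zero hw h0
  have hsplit : ∫ x, ⟪convect v w x + convect w v x, w x⟫
      = (∫ x, ⟪convect v w x, w x⟫) + ∫ x, ⟪convect w v x, w x⟫ := by
    simp_rw [inner_add_left]
    exact integral_add ((hv.convect hw).inner hw).integrable ((hw.convect hv).inner hw).integrable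
  have h1 : ∫ x, ⟪convect v w x, w x⟫ = 0 := integral_inner_convect_self_eq_zero' hv hdiv hw
  have h2 := (abs_le.1 (abs_integral_inner_convect_le_of_strain hw hS)).1
  have h3 : ν * (Λ * Y) ≤ ν * gradNormSq w := mul_le_mul_of_nonneg_left hP hν
  rw [hvisc, hsplit, h1, zero_add]
  nlinarith [h2, h3]

/-! ## (T1) The `H¹` level -/

/-- **(T1) `H¹` tail dissipativity of the linearised operator.** For smooth divergence-free `v`
with strain bound `s`, gradient bound `‖∂ₖv(x)‖ ≤ L` and Hessian-row bound
`(∑ⱼ‖∂ⱼ∂ₖv(x)‖²)^{1/2} ≤ L'`, and a smooth tail field `w` (`P_N w = 0`, `Λ = 4π²(N²+1)`,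
`G = ‖∇w‖₂² = Torus.gradNormSq w`):
`−ν‖Δw‖₂² + ∫⟪(v·∇)w + (w·∇)v, Δw⟫ − ω·G ≤ (−νΛ − ω + √d·L + s + √d·L'/√Λ)·G`. -/
theorem h1_tail_form_le {v w : UnitAddTorus d → EuclideanSpace ℝ d}
    (hv : IsSmooth v) (hdiv : IsDivFree v) (hw : IsSmooth w) {N : ℕ}
    (h0 : fourierTruncate N w = fun _ => 0) {ν ω s L L' : ℝ} (hν : 0 ≤ ν) (hL0 : 0 ≤ L)
    (hL'0 : 0 ≤ L')
    (hS : ∀ (x : UnitAddTorus d) (a : EuclideanSpace ℝ d), |⟪a, Torus.fderiv v x a⟫| ≤ s * ‖a‖ ^ 2)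
    (hL : ∀ (k : d) (x : UnitAddTorus d), ‖partialDeriv k v x‖ ≤ L)
    (hL' : ∀ (k : d) (x : UnitAddTorus d),
      Real.sqrt (∑ j, ‖partialDeriv j (partialDeriv k v) x‖ ^ 2) ≤ L') :
    -(ν * ∫ x, ‖laplacian w x‖ ^ 2)
      + (∫ x, ⟪convect v w x + convect w v x, laplacian w x⟫)
      - ω * gradNormSq w
      ≤ (-(ν * (4 * Real.pi ^ 2 * ((N : ℝ) ^ 2 + 1))) - ω
          + Real.sqrt (Fintype.card d) * L + s
          + Real.sqrt (Fintype.card d) * L' / Real.sqrt (4 * Real.pi ^ 2 * ((N : ℝ) ^ 2 + 1)))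
        * gradNormSq w := by
  -- names
  set Λ : ℝ := 4 * Real.pi ^ 2 * ((N : ℝ) ^ 2 + 1) with hΛ
  set D : ℝ := Real.sqrt (Fintype.card d) with hD
  set G : ℝ := gradNormSq w with hG
  set Y : ℝ := ∫ x, ‖w x‖ ^ 2 with hY
  obtain ⟨g, hg⟩ : ∃ g : UnitAddTorus d → ℝ,
      g = fun x => Real.sqrt (∑ j, ‖partialDeriv j w x‖ ^ 2) := ⟨_, rfl⟩
  have hgx : ∀ x, g x = Real.sqrt (∑ j, ‖partialDeriv j w x‖ ^ 2) := fun x => by rw [hg]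
  have hΛpos : 0 < Λ := by positivity
  have hsΛ : 0 < Real.sqrt Λ := Real.sqrt_pos.mpr hΛpos
  have hD0 : 0 ≤ D := Real.sqrt_nonneg _
  have hY0 : 0 ≤ Y := integral_nonneg fun x => sq_nonneg _
  have hg0 : ∀ x, 0 ≤ g x := fun x => by rw [hgx x]; exact Real.sqrt_nonneg _
  have hia : ∀ j, Integrable (fun x => ‖partialDeriv j w x‖ ^ 2) volume := fun j =>
    ((hw.partialDeriv j).norm_sq).integrable
  have hGdef : G = ∫ x, ∑ j, ‖partialDeriv j w x‖ ^ 2 := rfl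
  have hG0 : 0 ≤ G := gradNormSq_nonneg _
  have hg2 : ∀ x, g x ^ 2 = ∑ j, ‖partialDeriv j w x‖ ^ 2 := fun x => by
    rw [hgx x]; exact Real.sq_sqrt (Finset.sum_nonneg fun j _ => sq_nonneg _)
  have hGg : ∫ x, g x ^ 2 = G := by
    rw [hGdef]; exact integral_congr_ae (ae_of_all _ fun x => hg2 x)
  -- (1) viscous term and Poincaré
  have hP1 : Λ * G ≤ ∫ x, ‖laplacian w x‖ ^ 2 := gradNormSq_le_of_truncate_eq_zero hw h0
  have hP0 : Λ * Y ≤ G := integral_norm_sq_le_of_truncate_eq_zero hw h0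
  have hvisc : -(ν * ∫ x, ‖laplacian w x‖ ^ 2) ≤ -(ν * (Λ * G)) := by
    have := mul_le_mul_of_nonneg_left hP1 hν; linarith
  -- (2) the convective pairing, integrated by parts
  set F : UnitAddTorus d → EuclideanSpace ℝ d := fun x => convect v w x + convect w v x with hF
  have hFs : IsSmooth F := (hv.convect hw).add (hw.convect hv)
  have hibp : ∫ x, ⟪F x, laplacian w x⟫ = -∑ m, ∫ x, ⟪partialDeriv m F x, partialDeriv m w x⟫ :=
    integral_inner_laplacian_eq_neg_sum hFs hw
  -- Leibniz: ∂ₘF = (v·∇)∂ₘw + (∂ₘv·∇)w + (w·∇)∂ₘv + (∂ₘw·∇)v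
  have hLeib : ∀ m x, partialDeriv m F x
      = convect v (partialDeriv m w) x + convect (partialDeriv m v) w x
        + (convect w (partialDeriv m v) x + convect (partialDeriv m w) v x) := by
    intro m x
    have hF' : F = convect v w + convect w v := by funext y; rfl
    rw [hF', partialDeriv_add ((hv.convect hw).isContDiff (by simp)) ((hw.convect hv).isContDiff (by simp)),
      Pi.add_apply, partialDeriv_convect_eq_add_convect hv hw m x,
      partialDeriv_convect_eq_add_convect hw hv m x]
  -- the three first-order pieces, pointwise, and the vanishing top-order piece
  set p : d → UnitAddTorus d → ℝ := fun m x =>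
    ⟪convect (partialDeriv m v) w x + (convect w (partialDeriv m v) x
      + convect (partialDeriv m w) v x), partialDeriv m w x⟫ with hp
  have hps : ∀ m, IsSmooth (fun x => convect (partialDeriv m v) w x
      + (convect w (partialDeriv m v) x + convect (partialDeriv m w) v x)) := fun m =>
    ((hv.partialDeriv m).convect hw).add
      ((hw.convect (hv.partialDeriv m)).add ((hw.partialDeriv m).convect hv))
  have hpI : ∀ m, Integrable (p m) volume := fun m =>
    ((hps m).inner (hw.partialDeriv m)).integrable
  have hskew : ∀ m, ∫ x, ⟪convect v (partialDeriv m w) x, partialDeriv m w x⟫ = 0 := fun m =>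
    integral_inner_convect_self_eq_zero' hv hdiv (hw.partialDeriv m)
  have hterm : ∀ m, ∫ x, ⟪partialDeriv m F x, partialDeriv m w x⟫ = ∫ x, p m x := by
    intro m
    have e : ∀ x, ⟪partialDeriv m F x, partialDeriv m w x⟫
        = ⟪convect v (partialDeriv m w) x, partialDeriv m w x⟫ + p m x := by
      intro x
      rw [hLeib m x]
      simp only [hp]
      rw [← inner_add_left]
      congr 1
      abel
    simp_rw [e]
    rw [integral_add (((hv.convect (hw.partialDeriv m)).inner (hw.partialDeriv m)).integrable) (hpI m),
      hskew m, zero_add]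
  have hconv : ∫ x, ⟪F x, laplacian w x⟫ = -∫ x, ∑ m, p m x := by
    rw [hibp, integral_finsetSum _ fun m _ => hpI m]
    congr 1
    exact Finset.sum_congr rfl fun m _ => hterm m
  -- pointwise bound of each piece
  have hpt : ∀ m x, |p m x| ≤ ‖partialDeriv m w x‖ * (L * g x)
      + ‖partialDeriv m w x‖ * (L' * ‖w x‖) + s * ‖partialDeriv m w x‖ ^ 2 := by
    intro m x
    have hw1 : IsContDiff 1 w := hw.isContDiff (by simp)
    have hv1m : IsContDiff 1 (partialDeriv m v) := (hv.partialDeriv m).isContDiff (by simp)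
    -- piece (ii): (∂ₘv·∇)w
    have a1 : |⟪convect (partialDeriv m v) w x, partialDeriv m w x⟫|
        ≤ ‖partialDeriv m w x‖ * (L * g x) := by
      have hcv := norm_convect_le_norm_mul_sqrt hw1 (partialDeriv m v) x
      rw [← hgx x] at hcv
      calc |⟪convect (partialDeriv m v) w x, partialDeriv m w x⟫|
          ≤ ‖convect (partialDeriv m v) w x‖ * ‖partialDeriv m w x‖ := abs_real_inner_le_norm _ _
        _ ≤ (‖partialDeriv m v x‖ * g x) * ‖partialDeriv m w x‖ := by gcongr
        _ ≤ (L * g x) * ‖partialDeriv m w x‖ :=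
            mul_le_mul_of_nonneg_right (mul_le_mul_of_nonneg_right (hL m x) (hg0 x)) (norm_nonneg _)
        _ = ‖partialDeriv m w x‖ * (L * g x) := by ring
    -- piece (iii): (w·∇)∂ₘv
    have a2 : |⟪convect w (partialDeriv m v) x, partialDeriv m w x⟫|
        ≤ ‖partialDeriv m w x‖ * (L' * ‖w x‖) := by
      have hcv := norm_convect_le_norm_mul_sqrt hv1m w x
      calc |⟪convect w (partialDeriv m v) x, partialDeriv m w x⟫|
          ≤ ‖convect w (partialDeriv m v) x‖ * ‖partialDeriv m w x‖ := abs_real_inner_le_norm _ _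
        _ ≤ (‖w x‖ * Real.sqrt (∑ j, ‖partialDeriv j (partialDeriv m v) x‖ ^ 2))
              * ‖partialDeriv m w x‖ := by gcongr
        _ ≤ (‖w x‖ * L') * ‖partialDeriv m w x‖ :=
            mul_le_mul_of_nonneg_right (mul_le_mul_of_nonneg_left (hL' m x) (norm_nonneg _))
              (norm_nonneg _)
        _ = ‖partialDeriv m w x‖ * (L' * ‖w x‖) := by ring
    -- piece (iv): (∂ₘw·∇)v = Dv[∂ₘw], the strain form
    have a3 : |⟪convect (partialDeriv m w) v x, partialDeriv m w x⟫|
        ≤ s * ‖partialDeriv m w x‖ ^ 2 := by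
      rw [real_inner_comm]
      exact hS x (partialDeriv m w x)
    have hsum : p m x = ⟪convect (partialDeriv m v) w x, partialDeriv m w x⟫
        + ⟪convect w (partialDeriv m v) x, partialDeriv m w x⟫
        + ⟪convect (partialDeriv m w) v x, partialDeriv m w x⟫ := by
      simp only [hp, inner_add_left]
      ring
    rw [hsum]
    have t := (abs_add_le _ _).trans (add_le_add ((abs_add_le _ _).trans (add_le_add a1 a2)) a3)
    linarith
  -- sum over m, pointwise: Σₘ |pₘ| ≤ (D L + s) g² + D L' ‖w‖ g
  have hsum_pt : ∀ x, -(∑ m, p m x) ≤ (D * L + s) * g x ^ 2 + D * L' * (‖w x‖ * g x) := by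
    intro x
    have h1 : -(∑ m, p m x) ≤ ∑ m, |p m x| := by
      rw [← Finset.sum_neg_distrib]
      exact Finset.sum_le_sum fun m _ => neg_le_abs _
    have h2 : (∑ m, |p m x|) ≤ ∑ m, (‖partialDeriv m w x‖ * (L * g x)
        + ‖partialDeriv m w x‖ * (L' * ‖w x‖) + s * ‖partialDeriv m w x‖ ^ 2) :=
      Finset.sum_le_sum fun m _ => hpt m x
    have h3 : (∑ m, (‖partialDeriv m w x‖ * (L * g x)
        + ‖partialDeriv m w x‖ * (L' * ‖w x‖) + s * ‖partialDeriv m w x‖ ^ 2))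
        = (L * g x + L' * ‖w x‖) * (∑ m, ‖partialDeriv m w x‖) + s * g x ^ 2 := by
      rw [Finset.sum_add_distrib, Finset.sum_add_distrib, ← Finset.sum_mul, ← Finset.sum_mul,
        ← Finset.mul_sum, hg2 x]
      ring
    have h4 : (∑ m, ‖partialDeriv m w x‖) ≤ D * g x := by
      rw [hgx x]; exact sum_norm_partialDeriv_le_sqrt_card_mul w x
    have h5 : 0 ≤ L * g x + L' * ‖w x‖ :=
      add_nonneg (mul_nonneg hL0 (hg0 x)) (mul_nonneg hL'0 (norm_nonneg _))
    have h6 : (L * g x + L' * ‖w x‖) * (∑ m, ‖partialDeriv m w x‖)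
        ≤ (L * g x + L' * ‖w x‖) * (D * g x) := mul_le_mul_of_nonneg_left h4 h5
    have h7 : (L * g x + L' * ‖w x‖) * (D * g x) + s * g x ^ 2
        = (D * L + s) * g x ^ 2 + D * L' * (‖w x‖ * g x) := by ring
    linarith
  -- integrate
  have hgc : Continuous g := by rw [hg]; exact continuous_sqrt_sum_norm_partialDeriv_sq hw
  have hg2I : Integrable (fun x => g x ^ 2) volume := (hgc.pow 2).integrable_unitAddTorus
  have hwgI : Integrable (fun x => ‖w x‖ * g x) volume :=
    (hw.continuous.norm.mul hgc).integrable_unitAddTorus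
  have hint1 : -∫ x, ∑ m, p m x ≤ (D * L + s) * G + D * L' * ∫ x, ‖w x‖ * g x := by
    have hB : Integrable (fun x => (D * L + s) * g x ^ 2 + D * L' * (‖w x‖ * g x)) volume :=
      (hg2I.const_mul _).add (hwgI.const_mul _)
    have hSI : Integrable (fun x => ∑ m, p m x) volume := integrable_finsetSum _ fun m _ => hpI m
    have h1 : -∫ x, ∑ m, p m x = ∫ x, -(∑ m, p m x) := (integral_neg _).symm
    have h2 : ∫ x, -(∑ m, p m x) ≤ ∫ x, ((D * L + s) * g x ^ 2 + D * L' * (‖w x‖ * g x)) :=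
      integral_mono hSI.neg hB fun x => hsum_pt x
    have h3 : ∫ x, ((D * L + s) * g x ^ 2 + D * L' * (‖w x‖ * g x))
        = (D * L + s) * G + D * L' * ∫ x, ‖w x‖ * g x := by
      rw [integral_add (hg2I.const_mul _) (hwgI.const_mul _), integral_const_mul, integral_const_mul,
        hGg]
    rw [h1]
    exact h2.trans (le_of_eq h3)
  -- Cauchy–Schwarz and Poincaré for ∫ ‖w‖ g ≤ G / √Λ
  have hCS : ∫ x, ‖w x‖ * g x ≤ Real.sqrt Y * Real.sqrt G := by
    have h := integral_norm_mul_norm_le_sqrt_sq_mul_sqrt_sq (f := w) (g := g) (hw.memLp 2)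
      (hgc.memLp_of_hasCompactSupport (HasCompactSupport.of_compactSpace _))
    have e1 : (fun x => ‖w x‖ * ‖g x‖) = fun x => ‖w x‖ * g x := by
      funext x; rw [Real.norm_of_nonneg (hg0 x)]
    have e2 : (∫ x, ‖g x‖ ^ 2) = G := by
      rw [← hGg]
      exact integral_congr_ae (ae_of_all _ fun x => by
        show ‖g x‖ ^ 2 = g x ^ 2
        rw [Real.norm_of_nonneg (hg0 x)])
    rw [e1, e2] at h
    exact h
  have hsY : Real.sqrt Y ≤ Real.sqrt G / Real.sqrt Λ := by
    rw [le_div_iff₀ hsΛ, ← Real.sqrt_mul hY0]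
    refine Real.sqrt_le_sqrt ?_
    rw [mul_comm]; exact hP0
  have hwg : ∫ x, ‖w x‖ * g x ≤ G / Real.sqrt Λ := by
    have hsG : 0 ≤ Real.sqrt G := Real.sqrt_nonneg _
    calc ∫ x, ‖w x‖ * g x ≤ Real.sqrt Y * Real.sqrt G := hCS
      _ ≤ (Real.sqrt G / Real.sqrt Λ) * Real.sqrt G := mul_le_mul_of_nonneg_right hsY hsG
      _ = G / Real.sqrt Λ := by
          rw [div_mul_eq_mul_div, ← sq, Real.sq_sqrt hG0]
  -- assemble
  have hDL' : 0 ≤ D * L' := mul_nonneg hD0 hL'0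
  have hconv' : ∫ x, ⟪convect v w x + convect w v x, laplacian w x⟫
      ≤ (D * L + s) * G + D * L' * (G / Real.sqrt Λ) := by
    have e : (∫ x, ⟪convect v w x + convect w v x, laplacian w x⟫) = ∫ x, ⟪F x, laplacian w x⟫ :=
      rfl
    rw [e, hconv]
    exact hint1.trans (by nlinarith [mul_le_mul_of_nonneg_left hwg hDL'])
  have key : -(ν * ∫ x, ‖laplacian w x‖ ^ 2)
      + (∫ x, ⟪convect v w x + convect w v x, laplacian w x⟫) - ω * G
      ≤ -(ν * (Λ * G)) + ((D * L + s) * G + D * L' * (G / Real.sqrt Λ)) - ω * G := by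
    linarith
  have e : -(ν * (Λ * G)) + ((D * L + s) * G + D * L' * (G / Real.sqrt Λ)) - ω * G
      = (-(ν * Λ) - ω + D * L + s + D * L' / Real.sqrt Λ) * G := by
    simp only [div_eq_mul_inv]
    ring
  rw [e] at key
  exact key

end Summit.NavierStokesRegularity.FluidComputer.LinearisedLowerTailForms
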